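import Summits.CriticalPhenomena.PercolationContinuityZ3.Theorems.SahiCMTP2Basic
import Summits.CriticalPhenomena.PercolationContinuityZ3.Theorems.SahiCMTP2FourMeasures

/-!
# Density-free cMTP₂ (Fuchs–Wang 2026, (5.1)): the box criterion

Support file of the Sahi cell (`prim-sahi`, typer seat, generation 18; `--supports stmt-CriticalPhenomena-4575`).
Theorems only (no definitions, no named facts, no sorries).

For a finite measure `μ` on `ℝ^A × Y` (`A` finite, `Y` ANY measurable lattice — the second block is never
discretised) Fuchs–Wang's density-free conditional MTP₂ inequality (5.1),

  `μ(C × (−∞,x]) μ(D × (−∞,y]) ≤ μ((C ∧ D) × (−∞,x ∧ y]) μ((C ∨ D) × (−∞,x ∨ y])`  (all Borel `C, D ⊆ ℝ^A`, all `x, y`),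

holds as soon as it holds for closed boxes `C = [a,b]`, `D = [a',b']`:
**`isCMTP2Set_iff_isCMTP2Box`**.  Proof: for fixed `x, y` the four finite measures `C ↦ μ(C × (−∞,z])`,
`z = x, y, x ∧ y, x ∨ y` (`map_fst_restrict_prod_Iic_apply`) satisfy the hypothesis of the density-free four-measure
four functions theorem (`SahiCMTP2FourMeasures.quad_isCompact`); compact `C, D` first, then inner regularity at the
level of `μ` (so that non-measurable images `C ∧ D`, `C ∨ D` are read with the outer measure of `μ` itself).

This is the analogue, for (5.1), of Colangelo–Müller–Scarsini's Theorem 1 for their Definition 2, and the tool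
behind the closure theorem of the companion file `SahiCMTP2WeakLimits.lean`.

No sorries, no new axioms.  References: [FuchsWang2026] §5 (5.1); [ColangeloMullerScarsini2006] Thm. 1.
-/

noncomputable section

namespace Summit.CriticalPhenomena.PercolationContinuityZ3.Theorems.SahiCMTP2

open MeasureTheory Set Filter Topology Function
open Literature.Probability.LatticeModels Literature.Probability.LatticeModels.Affiliation
open scoped ENNReal SetFamily

section Slices

variable {X Y : Type*} [MeasurableSpace X] [MeasurableSpace Y] [Preorder Y]

/-- **The sliced first-block measure**: `((μ|_{X × (−∞,z]}) ∘ fst⁻¹)(C) = μ(C × (−∞,z])` for measurable `C`.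
[this work] -/
theorem map_fst_restrict_prod_Iic_apply (μ : Measure (X × Y)) (z : Y) {C : Set X} (hC : MeasurableSet C) :
    (μ.restrict (univ ×ˢ Iic z)).map Prod.fst C = μ (C ×ˢ Iic z) := by
  rw [Measure.map_apply measurable_fst hC, Measure.restrict_apply (measurable_fst hC)]
  congr 1
  ext p
  simp only [mem_inter_iff, mem_preimage, mem_prod, mem_univ, true_and]

end Slices

section Compact

variable {ι Y : Type*} [MeasurableSpace Y] [Lattice Y]

/-- Closed boxes of `ℝ^A` are compact, so the compact-set form of (5.1) contains the box form. [this work] -/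
theorem isCMTP2Box_of_isCompact (μ : Measure ((ι → ℝ) × Y))
    (h : ∀ ⦃K L : Set (ι → ℝ)⦄, IsCompact K → IsCompact L → ∀ x y : Y,
      μ (K ×ˢ Iic x) * μ (L ×ˢ Iic y) ≤ μ ((K ⊼ L) ×ˢ Iic (x ⊓ y)) * μ ((K ⊻ L) ×ˢ Iic (x ⊔ y))) :
    IsCMTP2Box μ := by
  intro a b a' b' x y
  have h1 : Icc a b ⊼ Icc a' b' ⊆ Icc (a ⊓ a') (b ⊓ b') :=
    Set.infs_subset_iff.2 fun u hu v hv => ⟨inf_le_inf hu.1 hv.1, inf_le_inf hu.2 hv.2⟩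
  have h2 : Icc a b ⊻ Icc a' b' ⊆ Icc (a ⊔ a') (b ⊔ b') :=
    Set.sups_subset_iff.2 fun u hu v hv => ⟨sup_le_sup hu.1 hv.1, sup_le_sup hu.2 hv.2⟩
  exact (h isCompact_Icc isCompact_Icc x y).trans
    (mul_le_mul' (measure_mono (prod_mono h1 Subset.rfl)) (measure_mono (prod_mono h2 Subset.rfl)))

end Compact

section BoxCriterion

variable {ι Y : Type*} [Fintype ι] [MeasurableSpace Y] [Lattice Y]

/-- **Box form ⟹ (5.1) for compact first-block sets.** [this work] -/
theorem isCompact_mul_le_of_isCMTP2Box (μ : Measure ((ι → ℝ) × Y)) [IsFiniteMeasure μ] (h : IsCMTP2Box μ)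
    {K L : Set (ι → ℝ)} (hK : IsCompact K) (hL : IsCompact L) (x y : Y) :
    μ (K ×ˢ Iic x) * μ (L ×ˢ Iic y) ≤ μ ((K ⊼ L) ×ˢ Iic (x ⊓ y)) * μ ((K ⊻ L) ×ˢ Iic (x ⊔ y)) := by
  set ν : Y → Measure (ι → ℝ) := fun z => (μ.restrict (univ ×ˢ Iic z)).map Prod.fst with hν
  have hνapp : ∀ (z : Y) {S : Set (ι → ℝ)}, MeasurableSet S → ν z S = μ (S ×ˢ Iic z) :=
    fun z S hS => map_fst_restrict_prod_Iic_apply μ z hS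
  haveI : ∀ z, IsFiniteMeasure (ν z) := fun z => by rw [hν]; infer_instance
  have hbox : ∀ a b a' b' : ι → ℝ, ν x (Icc a b) * ν y (Icc a' b') ≤
      ν (x ⊓ y) (Icc (a ⊓ a') (b ⊓ b')) * ν (x ⊔ y) (Icc (a ⊔ a') (b ⊔ b')) := by
    intro a b a' b'
    rw [hνapp x measurableSet_Icc, hνapp y measurableSet_Icc, hνapp _ measurableSet_Icc,
      hνapp _ measurableSet_Icc]
    exact h a b a' b' x y
  have h1 := quad_isCompact (ν x) (ν y) (ν (x ⊓ y)) (ν (x ⊔ y)) hbox hK hL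
  rwa [hνapp x hK.measurableSet, hνapp y hL.measurableSet, hνapp _ (isCompact_infs hK hL).measurableSet,
    hνapp _ (isCompact_sups hK hL).measurableSet] at h1

/-- **THE BOX CRITERION: box form ⟹ (5.1)** for every finite measure on `ℝ^A × Y` (all Borel `C, D`, images read
with outer measure), by inner regularity of the slices `C ↦ μ(C × (−∞,z])`. [this work] -/
theorem isCMTP2Set_of_isCMTP2Box (μ : Measure ((ι → ℝ) × Y)) [IsFiniteMeasure μ] (h : IsCMTP2Box μ) :
    IsCMTP2Set μ := by
  intro C D hC hD x y
  set R := μ ((C ⊼ D) ×ˢ Iic (x ⊓ y)) * μ ((C ⊻ D) ×ˢ Iic (x ⊔ y)) with hR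
  have hK : ∀ K, K ⊆ C → IsCompact K → ∀ L, L ⊆ D → IsCompact L → μ (K ×ˢ Iic x) * μ (L ×ˢ Iic y) ≤ R :=
    fun K hKC hK L hLD hL => (isCompact_mul_le_of_isCMTP2Box μ h hK hL x y).trans
      (mul_le_mul' (measure_mono (prod_mono (Set.infs_subset hKC hLD) Subset.rfl))
        (measure_mono (prod_mono (Set.sups_subset hKC hLD) Subset.rfl)))
  have hνapp : ∀ (z : Y) {S : Set (ι → ℝ)}, MeasurableSet S →
      (μ.restrict (univ ×ˢ Iic z)).map Prod.fst S = μ (S ×ˢ Iic z) :=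
    fun z S hS => map_fst_restrict_prod_Iic_apply μ z hS
  rw [← hνapp x hC, ← hνapp y hD, hC.measure_eq_iSup_isCompact_of_ne_top (measure_ne_top _ _),
    hD.measure_eq_iSup_isCompact_of_ne_top (measure_ne_top _ _)]
  rw [ENNReal.iSup_mul]; refine iSup_le fun K => ?_
  rw [ENNReal.iSup_mul]; refine iSup_le fun hKC => ?_
  rw [ENNReal.iSup_mul]; refine iSup_le fun hKc => ?_
  rw [ENNReal.mul_iSup]; refine iSup_le fun L => ?_
  rw [ENNReal.mul_iSup]; refine iSup_le fun hLD => ?_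
  rw [ENNReal.mul_iSup]; refine iSup_le fun hLc => ?_
  rw [hνapp x hKc.measurableSet, hνapp y hLc.measurableSet]
  exact hK K hKC hKc L hLD hLc

/-- **(5.1) ⟺ its box form**, for finite measures on `ℝ^A × Y`. [this work] -/
theorem isCMTP2Set_iff_isCMTP2Box (μ : Measure ((ι → ℝ) × Y)) [IsFiniteMeasure μ] :
    IsCMTP2Set μ ↔ IsCMTP2Box μ :=
  ⟨isCMTP2Box_of_isCMTP2Set, isCMTP2Set_of_isCMTP2Box μ⟩

/-- **Images of two nonempty closed boxes are the meet box** (any distributive lattice): take `u = w ∨ a`, `v = w ∨ a'`.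
[folklore] -/
theorem Icc_infs_Icc_of_le {α : Type*} [DistribLattice α] {a b a' b' : α} (hab : a ≤ b) (hab' : a' ≤ b') :
    Icc a b ⊼ Icc a' b' = Icc (a ⊓ a') (b ⊓ b') := by
  refine Subset.antisymm
    (Set.infs_subset_iff.2 fun u hu v hv => ⟨inf_le_inf hu.1 hv.1, inf_le_inf hu.2 hv.2⟩) fun w hw => ?_
  refine Set.mem_infs.2 ⟨w ⊔ a, ⟨le_sup_right, sup_le (hw.2.trans inf_le_left) hab⟩, w ⊔ a',
    ⟨le_sup_right, sup_le (hw.2.trans inf_le_right) hab'⟩, ?_⟩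
  rw [← sup_inf_left, sup_eq_left]
  exact hw.1

/-- Dually, **the join box**: `u = w ∧ b`, `v = w ∧ b'`. [folklore] -/
theorem Icc_sups_Icc_of_le {α : Type*} [DistribLattice α] {a b a' b' : α} (hab : a ≤ b) (hab' : a' ≤ b') :
    Icc a b ⊻ Icc a' b' = Icc (a ⊔ a') (b ⊔ b') := by
  refine Subset.antisymm
    (Set.sups_subset_iff.2 fun u hu v hv => ⟨sup_le_sup hu.1 hv.1, sup_le_sup hu.2 hv.2⟩) fun w hw => ?_
  refine Set.mem_sups.2 ⟨w ⊓ b, ⟨le_inf (le_sup_left.trans hw.1) hab, inf_le_right⟩, w ⊓ b',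
    ⟨le_inf (le_sup_right.trans hw.1) hab', inf_le_right⟩, ?_⟩
  rw [← inf_sup_left, inf_eq_left]
  exact hw.2

/-- **The tree's (5.1) ⟺ the printed (5.1).**  `IsCMTP2Set` quantifies over ALL measurable `C, D` and reads non-measurable
images `C ∧ D`, `C ∨ D` with outer measure; [FuchsWang2026] (5.1) quantifies over those Borel `C, D` whose images are
Borel.  The former trivially implies the latter; conversely the printed clause contains the box form (nonempty closed boxes
have the closed boxes `[a∧a', b∧b']`, `[a∨a', b∨b']` as images), hence the tree's form by the box criterion.  So every
theorem about `IsCMTP2Set` for finite measures on `ℝ^A × Y` (closure under weak limits, …) is a theorem about the printed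
(5.1). [this work] -/
theorem isCMTP2Set_iff_printed (μ : Measure ((ι → ℝ) × Y)) [IsFiniteMeasure μ] :
    IsCMTP2Set μ ↔ ∀ ⦃C D : Set (ι → ℝ)⦄, MeasurableSet C → MeasurableSet D → MeasurableSet (C ⊼ D) →
      MeasurableSet (C ⊻ D) → ∀ x y : Y,
        μ (C ×ˢ Iic x) * μ (D ×ˢ Iic y) ≤ μ ((C ⊼ D) ×ˢ Iic (x ⊓ y)) * μ ((C ⊻ D) ×ˢ Iic (x ⊔ y)) := by
  refine ⟨fun h C D hC hD _ _ x y => h hC hD x y, fun h => isCMTP2Set_of_isCMTP2Box μ fun a b a' b' x y => ?_⟩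
  by_cases hab : a ≤ b
  swap
  · rw [Set.Icc_eq_empty hab, Set.empty_prod, measure_empty, zero_mul]; exact bot_le
  by_cases hab' : a' ≤ b'
  swap
  · rw [Set.Icc_eq_empty hab', Set.empty_prod, measure_empty, mul_zero]; exact bot_le
  have e1 := Icc_infs_Icc_of_le hab hab'
  have e2 := Icc_sups_Icc_of_le hab hab'
  have key := h measurableSet_Icc measurableSet_Icc (e1 ▸ measurableSet_Icc) (e2 ▸ measurableSet_Icc) x y
  rwa [e1, e2] at key

end BoxCriterion

end Summit.CriticalPhenomena.PercolationContinuityZ3.Theorems.SahiCMTP2
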